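import Summits.AnomalousDissipation.AnomalousDissipation.Theorems.SolenoidalFractalHomogenisationLagrangianStepWindowDuality
import Literature.Analysis.FluidPDE.PassiveVectorTensorTranslate
import HarnessLib

/-!
# K1L_D (stmt-AnomalousDissipation-27980), line «onelevel-design», brick Z4♭ support: a `Torus.IsPropagator` family COMMUTES WITH THE SPATIAL
# TRANSLATIONS that leave its carrier invariant (helper; `--supports … --as helper`; lead-k1l-onelevel-p1 g4)

For the flat core Z4♭ of the bilinear cut (memo `Cruxes/LagrangianRenormalisationStep/Lines/onelevel-L8-bilinear-cut.md` §2) one needs, at the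
level of the abstract solution operators `Torus.IsPropagator T b 𝔸 U` (not only of weak solutions), that the cell propagator preserves Bloch
sectors and that the carrier-free propagator preserves Fourier supports.  Both follow from ONE statement: if the carrier is invariant under
the translation `x ↦ x + a` of the torus (`b t (x + a) = b t x`), then `U s t ∘ τ_a = τ_a ∘ U s t` on all of `L²`, where
`τ_a = Lp.compMeasurePreserving (· + a)` is the translation operator (generic dimension `d`):
* `inner_translate_eq` — `⟪τ_a f, g⟫ = ⟪f, τ_{−a} g⟫` (Haar invariance);
* `translate_mem_divFreeL2`, `inner_translate_eq_zero_of_orth` — `τ_a` preserves the weakly divergence-free classes and their orthogonal complement;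
* **`map_translate_eq`** — `U s t (τ_a x) = τ_a (U s t x)` for `0 ≤ s ≤ t ≤ T` and every `x ∈ L²`: on `(divFreeL2)ᗮ` both sides vanish; on
  `divFreeL2` the translate of the Lions solution from `x` is a solution from `τ_a x` along the SAME carrier
  (`IsWeakTensorPassiveVectorOn.translate`), `repr` identifies both sides for a.e. `t`, and weak continuity in `t` (`continuousOn`) gives every `t`.
Consumers: the cell carrier `cellField … n` / `E.level (m+1)` is invariant under the grid `(n⁻¹ℤ)³` (`cell_add_grid`), the free carrier `0` under
everything; so the real character averages of `…ClassReduction` / `…CellGridProjection` commute with both window propagators of Z4♭.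
NOT a proof of any registered stub, of the crux, or of AD; rung F-D1.A0.
-/

set_option linter.dupNamespace false  -- the summit-side namespace `Summit.AnomalousDissipation.AnomalousDissipation.…` repeats a component by design (D-0017)

noncomputable section

namespace Summit.AnomalousDissipation.AnomalousDissipation.Theorems.SolenoidalFractalHomogenisation.LagrangianStep.PropagatorSymm

open Literature.Analysis Literature.Analysis.FluidPDE Literature.Analysis.FluidPDE.Torus Literature.Analysis.FunctionSpaces
open MeasureTheory Set Filter UnitAddTorus Function
open scoped ENNReal NNReal InnerProductSpace
open WindowDuality (memLp_top_stLift_comp_add_left ae_isWeaklyDivFree_comp_add_left inner_toLp_left inner_toLp_toLp)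

variable {d : Type*} [Fintype d] [DecidableEq d]

/-! ## The translation operator on `L²(T^d; ℝ^d)` -/

omit [DecidableEq d] in
/-- The translation operator acts as composition, a.e. -/
theorem coeFn_translate (a : UnitAddTorus d) (f : Lp (EuclideanSpace ℝ d) 2 (volume : Measure (UnitAddTorus d))) :
    ((Lp.compMeasurePreserving (fun x : UnitAddTorus d => x + a) (measurePreserving_add_right volume a) f :
        Lp (EuclideanSpace ℝ d) 2 (volume : Measure (UnitAddTorus d))) : UnitAddTorus d → EuclideanSpace ℝ d)
      =ᵐ[volume] fun x => (f : UnitAddTorus d → EuclideanSpace ℝ d) (x + a) :=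
  Lp.coeFn_compMeasurePreserving f (measurePreserving_add_right volume a)

omit [DecidableEq d] in
/-- The translate of `toLp φ` is `toLp (φ ∘ (· + a))`. -/
theorem translate_toLp (a : UnitAddTorus d) {φ : UnitAddTorus d → EuclideanSpace ℝ d} (hφ : MemLp φ 2 volume) :
    Lp.compMeasurePreserving (fun x : UnitAddTorus d => x + a) (measurePreserving_add_right volume a) (hφ.toLp φ)
      = (hφ.comp_measurePreserving (measurePreserving_add_right volume a)).toLp (φ ∘ fun x => x + a) := by
  refine Lp.ext ?_
  refine (coeFn_translate a _).trans ?_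
  refine ((measurePreserving_add_right volume a).quasiMeasurePreserving.ae_eq_comp hφ.coeFn_toLp).trans ?_
  exact (MemLp.coeFn_toLp _).symm

omit [DecidableEq d] in
/-- **Haar invariance**: `⟪τ_a f, g⟫ = ⟪f, τ_{−a} g⟫`. -/
theorem inner_translate_eq (a : UnitAddTorus d) (f g : Lp (EuclideanSpace ℝ d) 2 (volume : Measure (UnitAddTorus d))) :
    ⟪Lp.compMeasurePreserving (fun x : UnitAddTorus d => x + a) (measurePreserving_add_right volume a) f, g⟫_ℝ
      = ⟪f, Lp.compMeasurePreserving (fun x : UnitAddTorus d => x + -a) (measurePreserving_add_right volume (-a)) g⟫_ℝ := by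
  rw [MeasureTheory.L2.inner_def, MeasureTheory.L2.inner_def]
  have h1 : (fun x => ⟪((Lp.compMeasurePreserving (fun x : UnitAddTorus d => x + a) (measurePreserving_add_right volume a) f :
        Lp (EuclideanSpace ℝ d) 2 (volume : Measure (UnitAddTorus d))) : UnitAddTorus d → EuclideanSpace ℝ d) x,
        (g : UnitAddTorus d → EuclideanSpace ℝ d) x⟫_ℝ)
      =ᵐ[volume] fun x => ⟪(f : UnitAddTorus d → EuclideanSpace ℝ d) (x + a), (g : UnitAddTorus d → EuclideanSpace ℝ d) (x + a + -a)⟫_ℝ := by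
    filter_upwards [coeFn_translate a f] with x hx
    rw [hx, add_neg_cancel_right]
  have h2 : (fun x => ⟪(f : UnitAddTorus d → EuclideanSpace ℝ d) x,
        ((Lp.compMeasurePreserving (fun x : UnitAddTorus d => x + -a) (measurePreserving_add_right volume (-a)) g :
          Lp (EuclideanSpace ℝ d) 2 (volume : Measure (UnitAddTorus d))) : UnitAddTorus d → EuclideanSpace ℝ d) x⟫_ℝ)
      =ᵐ[volume] fun x => ⟪(f : UnitAddTorus d → EuclideanSpace ℝ d) x, (g : UnitAddTorus d → EuclideanSpace ℝ d) (x + -a)⟫_ℝ := by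
    filter_upwards [coeFn_translate (-a) g] with x hx
    rw [hx]
  rw [integral_congr_ae h1, integral_congr_ae h2]
  exact integral_add_right_eq_self (μ := (volume : Measure (UnitAddTorus d)))
    (fun x => ⟪(f : UnitAddTorus d → EuclideanSpace ℝ d) x, (g : UnitAddTorus d → EuclideanSpace ℝ d) (x + -a)⟫_ℝ) a

omit [DecidableEq d] in
/-- Translates of weakly divergence-free classes are weakly divergence free. -/
theorem translate_mem_divFreeL2 (a : UnitAddTorus d) {f : Lp (EuclideanSpace ℝ d) 2 (volume : Measure (UnitAddTorus d))}
    (hf : f ∈ divFreeL2 d) :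
    Lp.compMeasurePreserving (fun x : UnitAddTorus d => x + a) (measurePreserving_add_right volume a) f ∈ divFreeL2 d := by
  rw [mem_divFreeL2_iff] at hf ⊢
  exact (hf.translate a).congr_ae (coeFn_translate a f).symm

omit [DecidableEq d] in
/-- Translates of classes orthogonal to `divFreeL2` are orthogonal to `divFreeL2`. -/
theorem inner_translate_eq_zero_of_orth (a : UnitAddTorus d) {f : Lp (EuclideanSpace ℝ d) 2 (volume : Measure (UnitAddTorus d))}
    (hf : ∀ z : Lp (EuclideanSpace ℝ d) 2 (volume : Measure (UnitAddTorus d)),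
      FunctionSpaces.Torus.IsWeaklyDivFree (z : UnitAddTorus d → EuclideanSpace ℝ d) → ⟪f, z⟫_ℝ = 0)
    (z : Lp (EuclideanSpace ℝ d) 2 (volume : Measure (UnitAddTorus d)))
    (hz : FunctionSpaces.Torus.IsWeaklyDivFree (z : UnitAddTorus d → EuclideanSpace ℝ d)) :
    ⟪Lp.compMeasurePreserving (fun x : UnitAddTorus d => x + a) (measurePreserving_add_right volume a) f, z⟫_ℝ = 0 := by
  rw [inner_translate_eq]
  exact hf _ ((mem_divFreeL2_iff _).1 (translate_mem_divFreeL2 (-a) ((mem_divFreeL2_iff z).2 hz)))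

/-! ## Propagators commute with the translations that fix the carrier -/

variable {T : ℝ} {𝔸 : Visc4 d} {lo hi : ℝ} {b : ℝ → UnitAddTorus d → EuclideanSpace ℝ d}
  {U : ℝ → ℝ → (Lp (EuclideanSpace ℝ d) 2 (volume : Measure (UnitAddTorus d)) →L[ℝ]
    Lp (EuclideanSpace ℝ d) 2 (volume : Measure (UnitAddTorus d)))}

/-- The divergence-free case on the open window: for `x ∈ divFreeL2`, `0 ≤ s < T`, `U s (s+τ') (τ_a x) = τ_a (U s (s+τ') x)` for a.e.
`τ' ∈ (0, T − s)` (translate the Lions solution; `repr` on both sides). -/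
theorem ae_map_translate_eq_of_mem (hU : IsPropagator T b 𝔸 U) (h𝔸 : NearIso 𝔸 lo hi) (hlo : 0 < lo)
    (hb : MemLp (FunctionSpaces.Torus.stLift b) ∞ (volume.restrict (Ioo 0 T ×ˢ univ)))
    (hbdiv : ∀ᵐ t ∂(volume.restrict (Ioo 0 T)), FunctionSpaces.Torus.IsWeaklyDivFree (b t))
    (a : UnitAddTorus d) (hper : ∀ t x, b t (x + a) = b t x)
    {s : ℝ} (hs : 0 ≤ s) (hsT : s < T) {x : Lp (EuclideanSpace ℝ d) 2 (volume : Measure (UnitAddTorus d))} (hx : x ∈ divFreeL2 d) :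
    ∀ᵐ τ' ∂(volume.restrict (Ioo 0 (T - s))),
      U s (s + τ') (Lp.compMeasurePreserving (fun y : UnitAddTorus d => y + a) (measurePreserving_add_right volume a) x)
        = Lp.compMeasurePreserving (fun y : UnitAddTorus d => y + a) (measurePreserving_add_right volume a) (U s (s + τ') x) := by
  have hxdiv : FunctionSpaces.Torus.IsWeaklyDivFree (x : UnitAddTorus d → EuclideanSpace ℝ d) := (mem_divFreeL2_iff x).1 hx
  -- the Lions solution from `x` on the window and its translate
  obtain ⟨w, hw⟩ := exists_isWeakTensorPassiveVectorOn (sub_pos.2 hsT) h𝔸 hlo (memLp_top_stLift_comp_add_left hb hs)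
    (ae_isWeaklyDivFree_comp_add_left hbdiv hs) (Lp.memLp x) hxdiv
  have hwa := hw.translate a
  have hcar : (fun τ' (y : UnitAddTorus d) => b (s + τ') (y + a)) = fun τ' => b (s + τ') := by
    funext τ' y; exact hper _ _
  rw [hcar] at hwa
  have hφa : MemLp (fun y => (x : UnitAddTorus d → EuclideanSpace ℝ d) (y + a)) 2 volume :=
    (Lp.memLp x).comp_measurePreserving (measurePreserving_add_right volume a)
  have hφadiv : FunctionSpaces.Torus.IsWeaklyDivFree (fun y => (x : UnitAddTorus d → EuclideanSpace ℝ d) (y + a)) := hxdiv.translate a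
  have ex : hφa.toLp _ = Lp.compMeasurePreserving (fun y : UnitAddTorus d => y + a) (measurePreserving_add_right volume a) x :=
    Lp.ext ((MemLp.coeFn_toLp _).trans (coeFn_translate a x).symm)
  have r1 := hU.repr s hs hsT _ (Lp.memLp x) hxdiv w hw
  have r2 := hU.repr s hs hsT _ hφa hφadiv _ hwa
  filter_upwards [r1, r2] with τ' h1 h2
  obtain ⟨hm1, e1⟩ := h1
  obtain ⟨hm2, e2⟩ := h2
  have e1' : U s (s + τ') x = hm1.toLp (w τ') := by rw [e1, Lp.toLp_coeFn]
  have e2' : U s (s + τ') (Lp.compMeasurePreserving (fun y : UnitAddTorus d => y + a) (measurePreserving_add_right volume a) x)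
      = hm2.toLp (fun y => w τ' (y + a)) := by rw [← ex]; exact e2.symm
  rw [e2', e1', translate_toLp]
  exact MemLp.toLp_congr _ _ (Filter.Eventually.of_forall fun y => rfl)

/-- **A propagator commutes with every translation fixing its carrier**: `U s t (τ_a x) = τ_a (U s t x)` for `0 ≤ s ≤ t ≤ T`, all `x ∈ L²`. -/
theorem map_translate_eq (hU : IsPropagator T b 𝔸 U) (h𝔸 : NearIso 𝔸 lo hi) (hlo : 0 < lo)
    (hb : MemLp (FunctionSpaces.Torus.stLift b) ∞ (volume.restrict (Ioo 0 T ×ˢ univ)))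
    (hbdiv : ∀ᵐ t ∂(volume.restrict (Ioo 0 T)), FunctionSpaces.Torus.IsWeaklyDivFree (b t))
    (a : UnitAddTorus d) (hper : ∀ t x, b t (x + a) = b t x)
    {s t : ℝ} (hs : 0 ≤ s) (hst : s ≤ t) (htT : t ≤ T) (x : Lp (EuclideanSpace ℝ d) 2 (volume : Measure (UnitAddTorus d))) :
    U s t (Lp.compMeasurePreserving (fun y : UnitAddTorus d => y + a) (measurePreserving_add_right volume a) x)
      = Lp.compMeasurePreserving (fun y : UnitAddTorus d => y + a) (measurePreserving_add_right volume a) (U s t x) := by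
  -- split `x` along `divFreeL2 ⊕ (divFreeL2)ᗮ`; the orthogonal part is killed on both sides
  set P := (divFreeL2 d).starProjection with hP
  have hxP : P x ∈ divFreeL2 d := (divFreeL2 d).starProjection_apply_mem x
  have horth : ∀ z : Lp (EuclideanSpace ℝ d) 2 (volume : Measure (UnitAddTorus d)),
      FunctionSpaces.Torus.IsWeaklyDivFree (z : UnitAddTorus d → EuclideanSpace ℝ d) → ⟪x - P x, z⟫_ℝ = 0 :=
    fun z hz => (divFreeL2 d).inner_left_of_mem_orthogonal ((mem_divFreeL2_iff z).2 hz) ((divFreeL2 d).sub_starProjection_mem_orthogonal x)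
  have h0 : U s t (x - P x) = 0 := hU.eq_zero_of_orth s t _ horth
  have h0' : U s t (Lp.compMeasurePreserving (fun y : UnitAddTorus d => y + a) (measurePreserving_add_right volume a) (x - P x)) = 0 :=
    hU.eq_zero_of_orth s t _ (inner_translate_eq_zero_of_orth a horth)
  have ex : x = P x + (x - P x) := by abel
  conv_lhs => rw [ex, map_add, map_add, h0', add_zero]
  conv_rhs => rw [ex, map_add, h0, add_zero]
  -- the divergence-free part: every `t` from a.e. `t` by weak continuity
  rcases eq_or_lt_of_le (hst.trans htT) with hsT | hsT
  · -- `s = T`, hence `t = s`: both sides are the identity on divergence-free classes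
    have hts : t = s := le_antisymm (hsT ▸ htT) hst
    subst hts
    rw [hU.self_of_divFree t hs htT _ ((mem_divFreeL2_iff _).1 (translate_mem_divFreeL2 a hxP)),
      hU.self_of_divFree t hs htT _ ((mem_divFreeL2_iff _).1 hxP)]
  · have hae := ae_map_translate_eq_of_mem hU h𝔸 hlo hb hbdiv a hper hs hsT hxP
    -- compare the weakly continuous functions `τ' ↦ ⟪lhs(s+τ'), z⟫` and `τ' ↦ ⟪rhs(s+τ'), z⟫` on `[0, T − s]`
    refine ext_inner_right ℝ fun z => ?_
    have hshift : ∀ τ' ∈ Icc 0 (T - s), s + τ' ∈ Icc s T := fun τ' hτ' => ⟨by linarith [hτ'.1], by linarith [hτ'.2]⟩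
    have hc1 : ContinuousOn (fun τ' => ⟪U s (s + τ')
        (Lp.compMeasurePreserving (fun y : UnitAddTorus d => y + a) (measurePreserving_add_right volume a) (P x)), z⟫_ℝ) (Icc 0 (T - s)) :=
      (hU.continuousOn s hs hsT.le _ z).comp (continuousOn_const.add continuousOn_id) hshift
    have hc2 : ContinuousOn (fun τ' => ⟪Lp.compMeasurePreserving (fun y : UnitAddTorus d => y + a) (measurePreserving_add_right volume a)
        (U s (s + τ') (P x)), z⟫_ℝ) (Icc 0 (T - s)) := by
      have e : (fun τ' => ⟪Lp.compMeasurePreserving (fun y : UnitAddTorus d => y + a) (measurePreserving_add_right volume a)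
          (U s (s + τ') (P x)), z⟫_ℝ) = fun τ' => ⟪U s (s + τ') (P x),
            Lp.compMeasurePreserving (fun y : UnitAddTorus d => y + -a) (measurePreserving_add_right volume (-a)) z⟫_ℝ := by
        funext τ'; exact inner_translate_eq a _ z
      rw [e]
      exact (hU.continuousOn s hs hsT.le _ _).comp (continuousOn_const.add continuousOn_id) hshift
    have haeI : (fun τ' => ⟪U s (s + τ')
        (Lp.compMeasurePreserving (fun y : UnitAddTorus d => y + a) (measurePreserving_add_right volume a) (P x)), z⟫_ℝ)
        =ᵐ[volume.restrict (Icc 0 (T - s))] fun τ' => ⟪Lp.compMeasurePreserving (fun y : UnitAddTorus d => y + a)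
          (measurePreserving_add_right volume a) (U s (s + τ') (P x)), z⟫_ℝ := by
      rw [Measure.restrict_congr_set Ioo_ae_eq_Icc.symm]
      filter_upwards [hae] with τ' hτ'
      rw [hτ']
    have hmem : t - s ∈ Icc 0 (T - s) := ⟨by linarith, by linarith⟩
    have key := Measure.eqOn_Icc_of_ae_eq (volume : Measure ℝ) (sub_pos.2 hsT).ne haeI hc1 hc2 hmem
    simp only [add_sub_cancel] at key
    exact key

end Summit.AnomalousDissipation.AnomalousDissipation.Theorems.SolenoidalFractalHomogenisation.LagrangianStep.PropagatorSymm

end
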